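import Literature.Analysis.FluidPDE.SereginEpsilonRegularity
import Literature.Analysis.FluidPDE.CKNInterpolationEstimate
import Literature.Analysis.FluidPDE.NSSuitableESSProofs
import Literature.Analysis.FluidPDE.CKNLocalEnergyEstimate
import Literature.Analysis.FluidPDE.CKNUnforcedOneScaleRRS
import HarnessLib

/-!
# Seregin 2014, Ch. 6, Theorem 1.4 from the tree's Caffarelli–Kohn–Nirenberg leaves

Analysis/FluidPDE proof file (no definitions, no new named facts) in the decomposition of the
named fact `Literature.Analysis.FluidPDE.seregin2014_thm14` (`SereginEpsilonRegularity.lean`;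
G. Seregin, *Lecture Notes on Regularity Theory for the Navier–Stokes Equations*, World
Scientific 2014, Ch. 6, §6.1, **Theorem 1.4**, PDF p. 94: a suitable weak solution `(v, q)` in
`Q = Q(0, 1)` with `sup_{0<r<1} E(r) < ε`, `E(r) = r⁻¹ ∫_{Q(r)} |∇v|²`, is regular at the vertex
`z = 0`).

Main result: `seregin2014_thm14_of_estimates :
  localEnergyEstimate → pressureEstimate → lemarieRieusset_epsilon_regularity → seregin2014_thm14`,
and, feeding the tree's theorem `localEnergyEstimate_holds` (`CKNLocalEnergyEstimate.lean`),
`seregin2014_thm14_of_pressureEstimate_of_lemarieRieusset :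
  pressureEstimate → lemarieRieusset_epsilon_regularity → seregin2014_thm14` (the two leaves of
the fact that are still open), as well as the **unforced route**
`seregin2014_thm14_of_pressureEstimate_of_theorem15_3 :
  pressureEstimate → RRS2016.theorem15_3 → seregin2014_thm14`, which replaces Lemarié-Rieusset's
Thm. 14.4 (force `f ∈ L^q`, arbitrary `ν`) by Robinson–Rodrigo–Sadowski's unforced Thm. 15.3 at
unit scale (`CKNLocalRegularityRRS.lean`; the tree's decomposition of Thm. 14.4 runs through it),
via `unforced_epsilonRegularity_of_theorem15_3` (`CKNUnforcedOneScaleRRS.lean`).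

The printed proof (Seregin 2014, pp. 94–100: Lemmas 6.2–6.4, the iteration (6.1.44)–(6.1.52) for
`𝓔(r) = A^{3/2}(r) + D₀²(r)`, then Lemma 6.1 on `Q(r₀)`; "here, we follow F.-H. Lin's
arguments") has the architecture of every proof of Caffarelli–Kohn–Nirenberg's Proposition 2,
whose Lin / Robinson–Rodrigo–Sadowski form the tree already carries as the decomposition targets
of ns.S12 (`CKNEpsilonRegularityAssembly.lean`): the local-energy estimate `localEnergyEstimate`
(Robinson–Rodrigo–Sadowski 2016, (16.13); Seregin's Lemma 6.3), the pressure estimate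
`pressureEstimate` (ibid., Lemma 16.7; Seregin's Lemma 6.4), the interpolation inequality
`interpolationEstimate` (ibid., Lemma 15.10; Seregin's Lemma 6.2 — **proved**,
`interpolationEstimate_holds`), fed into the abstract real scheme `CKN1982.decay_scheme`
(Seregin's (6.1.46)–(6.1.52)), and a one-scale criterion (Seregin's Lemma 6.1). This file proves
Theorem 1.4 from these leaves, the one-scale criterion being taken in the form of
Lemarié-Rieusset 2016, Thm. 14.4 (`lemarieRieusset_epsilon_regularity`, quantitative and stated on
open backward cylinders `Q_{r₀}(z₀) ⊆ Ω`, hence applicable **at the vertex** of `Q(0, 1)`, which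
the interior criterion `oneScaleRegularity` is not).

## The proof

The estimates of the tree are stated for cylinders with `closure Q_r(z) ⊆ Q`; at the vertex
`z = (t, x)` of `Q = Q(z, 1)` this fails. The scheme is therefore run at centres shifted into the
**past**, `z_h = (t - h, x)`, `0 < h ≤ ρ²` (`seregin2014_shifted_smallness_of_estimates`):

1. *A-priori bounds, uniform in `h`.* The global classes of `IsSuitableWeakSolutionInBall 1 z`
   give `A(r; z_h) ≤ r⁻¹ C`, `D(r; z_h) ≤ r⁻² N_p` for `Q_r(z_h) ⊆ Q(z, 1)`; the dissipation is
   controlled by the hypothesis: `Q_s(z_h) ⊆ Q_{2s}(z)` for `h ≤ s²`, so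
   `E(s; z_h) ≤ 2 E(2s; z) < 2 · (ε/2)` (`cknE_pastShift_le`).
2. *The scheme.* With the constants of the three estimates `CKN1982.decay_scheme` yields `θ`, the
   dissipation threshold (twice the `ε` of Theorem 1.4) and, from the a-priori bound at
   `r₀ = 1/4`, the number of steps `k`; `ρ = θᵏ/4` is fixed **before** `h`, and for every
   `0 < h ≤ ρ²` the scheme gives `C(ρ; z_h) + D(ρ; z_h) ≤ ε₀'` (Seregin's "for sufficiently small
   `ε` and `r₀`, `C(r₀) + D₀(r₀) < ε₀`", p. 100, at the shifted centres).
3. *The limit `h → 0⁺`* (`setLIntegral_parabolicCylinder_le_of_pastShift`):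
   `Q_ρ(z) ∩ {s < t - h} ⊆ Q_ρ(z_h)` and `Q_ρ(z) = ⋃ₙ (Q_ρ(z) ∩ {s < t - hₙ})`, so by continuity
   from below `C(ρ; z) + D(ρ; z) ≤ ε₀'` (`seregin2014_vertex_smallness_of_estimates`).
4. *The one-scale criterion at the vertex* (`seregin2014_thm14_of_estimates`, `z = 0`): the
   hypotheses of Thm. 14.4 on the domain `Ω = Q(0, 1)` (connected) are the global classes of
   `IsSuitableWeakSolutionInBall` (the `L²` bound of the energy-inequality gradient through a.e.
   uniqueness of weak gradients, `HasWeakSpatialGradientOn.ae_eq`), and with `λ = ε₁`,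
   `ε₀' = ε₁³`, Thm. 14.4 bounds `|v| ≤ C₀ ε₁ / ρ` a.e. on `Q_{ρ/2}(0)`.

## References

* G. Seregin, *Lecture Notes on Regularity Theory for the Navier–Stokes Equations*, World
  Scientific 2014, Ch. 6, §6.1, Lemmas 6.1–6.4, Theorem 1.4 and its proof, pp. 90–100.
  [Seregin2014]
* J. C. Robinson, J. L. Rodrigo, W. Sadowski, *The three-dimensional Navier–Stokes equations*,
  CUP 2016, proof of Thm. 16.1, (16.13)–(16.20); Lemmas 15.10, 16.7. [RobinsonRodrigoSadowski2016]
* P. G. Lemarié-Rieusset, *The Navier–Stokes Problem in the 21st Century*, CRC 2016, Thm. 14.4.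
  [LemarieRieusset2016]
* F. Lin, Comm. Pure Appl. Math. 51 (1998), Thm. 1.1. [Lin1998]
* L. Caffarelli, R. Kohn, L. Nirenberg, Comm. Pure Appl. Math. 35 (1982), Props. 1–2.
  [CaffarelliKohnNirenberg1982]
-/

noncomputable section

open MeasureTheory Set Function Filter TopologicalSpace Metric
open scoped NNReal ENNReal InnerProductSpace RealInnerProductSpace Laplacian Topology

namespace Literature.Analysis.FluidPDE

/-! ### Geometry of backward cylinders with centres shifted into the past -/

section Geometry

variable {X : Type*} [PseudoMetricSpace X]

/-- `Q_s(t - h, x) ⊆ Q_{2s}(t, x)` for `0 ≤ h ≤ s²` (a cylinder whose top lies slightly in the past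
of `t` sits inside the backward cylinder of doubled radius at `t`). [folklore] -/
theorem parabolicCylinder_pastShift_subset_double {s h : ℝ} (hs : 0 ≤ s) (h0 : 0 ≤ h)
    (hh : h ≤ s ^ 2) (z : ℝ × X) :
    parabolicCylinder s (z.1 - h, z.2) ⊆ parabolicCylinder (2 * s) z := by
  intro w hw
  rw [mem_parabolicCylinder] at hw ⊢
  obtain ⟨⟨h1, h2⟩, h3⟩ := hw
  dsimp only at h1 h2 h3
  exact ⟨⟨by nlinarith, by linarith⟩, h3.trans_le (by linarith)⟩

/-- `closure Q_r(t - h, x) ⊆ Q_R(t, x)` when `0 < h`, `r < R` and `h + r² < R²`. [folklore] -/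
theorem closure_parabolicCylinder_pastShift_subset {r h R : ℝ} (h0 : 0 < h) (hrR : r < R)
    (hsum : h + r ^ 2 < R ^ 2) (z : ℝ × EuclideanSpace ℝ (Fin 3)) :
    closure (parabolicCylinder r (z.1 - h, z.2)) ⊆ parabolicCylinder R z := by
  refine (closure_parabolicCylinder_subset r _).trans ?_
  rintro w ⟨hw1, hw2⟩
  rw [mem_Icc] at hw1
  rw [mem_closedBall] at hw2
  rw [mem_parabolicCylinder]
  dsimp only at hw1 hw2
  exact ⟨⟨by linarith [hw1.1], by linarith [hw1.2]⟩, lt_of_le_of_lt hw2 hrR⟩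

/-- The part of `Q_ρ(t, x)` below the level `t - h` lies in `Q_ρ(t - h, x)` (`0 ≤ h`). [folklore] -/
theorem parabolicCylinder_inter_setOf_lt_subset_pastShift {ρ h : ℝ} (h0 : 0 ≤ h) (z : ℝ × X) :
    parabolicCylinder ρ z ∩ {w | w.1 < z.1 - h} ⊆ parabolicCylinder ρ (z.1 - h, z.2) := by
  rintro w ⟨hw, hlt⟩
  rw [mem_parabolicCylinder] at hw ⊢
  obtain ⟨⟨h1, -⟩, h3⟩ := hw
  exact ⟨⟨by dsimp only; linarith, hlt⟩, h3⟩

end Geometry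

/-! ### Measure-theoretic glue -/

section Glue

variable {X : Type*} [PseudoMetricSpace X] [MeasureSpace X]

/-- **Continuity from below at the vertex.** If `∫_{Q_ρ(t - h, x)} f ≤ B` for all small `h > 0`,
then `∫_{Q_ρ(t, x)} f ≤ B`: `Q_ρ(t, x)` is the increasing union of its parts below the levels
`t - hₙ`, `hₙ ↓ 0`, each inside `Q_ρ(t - hₙ, x)` (no measurability of `f` is needed,
`setLIntegral_iUnion_of_directed`). [folklore] -/
theorem setLIntegral_parabolicCylinder_le_of_pastShift {f : ℝ × X → ℝ≥0∞} {ρ η : ℝ} (hη : 0 < η)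
    (z : ℝ × X) {B : ℝ≥0∞}
    (h : ∀ h', 0 < h' → h' < η → ∫⁻ w in parabolicCylinder ρ (z.1 - h', z.2), f w ≤ B) :
    ∫⁻ w in parabolicCylinder ρ z, f w ≤ B := by
  set s : ℕ → Set (ℝ × X) := fun n => parabolicCylinder ρ z ∩ {w | w.1 < z.1 - η / ((n : ℝ) + 2)}
    with hs
  have hmono : Monotone s := by
    intro n m hnm w hw
    obtain ⟨hw1, hw2⟩ := hw
    refine ⟨hw1, ?_⟩
    rw [mem_setOf_eq] at hw2 ⊢
    have hcast : (n : ℝ) + 2 ≤ (m : ℝ) + 2 := by exact_mod_cast Nat.add_le_add_right hnm 2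
    have : η / ((m : ℝ) + 2) ≤ η / ((n : ℝ) + 2) :=
      div_le_div_of_nonneg_left hη.le (by positivity) hcast
    linarith
  have hcover : parabolicCylinder ρ z ⊆ ⋃ n, s n := by
    intro w hw
    have hw1 : w.1 < z.1 := ((mem_parabolicCylinder.1 hw).1).2
    have hδ : 0 < z.1 - w.1 := by linarith
    obtain ⟨n, hn⟩ := exists_nat_gt (η / (z.1 - w.1))
    refine mem_iUnion.2 ⟨n, hw, ?_⟩
    show w.1 < z.1 - η / ((n : ℝ) + 2)
    have hlt : η / ((n : ℝ) + 2) < z.1 - w.1 := by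
      rw [div_lt_iff₀ (by positivity)]
      have h1 : η < (n : ℝ) * (z.1 - w.1) := (div_lt_iff₀ hδ).1 hn
      nlinarith
    linarith
  have hsub : ∀ n, s n ⊆ parabolicCylinder ρ (z.1 - η / ((n : ℝ) + 2), z.2) := fun n =>
    parabolicCylinder_inter_setOf_lt_subset_pastShift (by positivity) z
  calc ∫⁻ w in parabolicCylinder ρ z, f w ≤ ∫⁻ w in ⋃ n, s n, f w := lintegral_mono_set hcover
    _ = ⨆ n, ∫⁻ w in s n, f w := setLIntegral_iUnion_of_directed f hmono.directed_le
    _ ≤ B := iSup_le fun n => (lintegral_mono_set (hsub n)).trans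
        (h _ (by positivity) (by
          rw [div_lt_iff₀ (by positivity)]
          nlinarith))

/-- Scaled form of the continuity from below at the vertex, for the quantities
`r⁻² ∫_{Q_ρ(·)} f` (`cknC`, `cknD`). [folklore] -/
theorem scaledSetLIntegral_le_of_pastShift {f : ℝ × X → ℝ≥0∞} {ρ η : ℝ} (hρ : 0 < ρ) (hη : 0 < η)
    (z : ℝ × X) {B : ℝ≥0∞}
    (h : ∀ h', 0 < h' → h' < η →
      (ENNReal.ofReal ρ ^ 2)⁻¹ * ∫⁻ w in parabolicCylinder ρ (z.1 - h', z.2), f w ≤ B) :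
    (ENNReal.ofReal ρ ^ 2)⁻¹ * ∫⁻ w in parabolicCylinder ρ z, f w ≤ B := by
  have hr0 : ENNReal.ofReal ρ ^ 2 ≠ 0 := pow_ne_zero _ (ENNReal.ofReal_pos.2 hρ).ne'
  have hrt : ENNReal.ofReal ρ ^ 2 ≠ ∞ := ENNReal.pow_ne_top ENNReal.ofReal_ne_top
  have hI : ∫⁻ w in parabolicCylinder ρ z, f w ≤ ENNReal.ofReal ρ ^ 2 * B := by
    refine setLIntegral_parabolicCylinder_le_of_pastShift hη z fun h' hh' hh'η => ?_
    have H := h h' hh' hh'η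
    calc ∫⁻ w in parabolicCylinder ρ (z.1 - h', z.2), f w
        = ENNReal.ofReal ρ ^ 2 * ((ENNReal.ofReal ρ ^ 2)⁻¹ *
            ∫⁻ w in parabolicCylinder ρ (z.1 - h', z.2), f w) := by
          rw [← mul_assoc, ENNReal.mul_inv_cancel hr0 hrt, one_mul]
      _ ≤ ENNReal.ofReal ρ ^ 2 * B := mul_le_mul_right H _
  calc (ENNReal.ofReal ρ ^ 2)⁻¹ * ∫⁻ w in parabolicCylinder ρ z, f w
      ≤ (ENNReal.ofReal ρ ^ 2)⁻¹ * (ENNReal.ofReal ρ ^ 2 * B) := mul_le_mul_right hI _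
    _ = B := by rw [← mul_assoc, ENNReal.inv_mul_cancel hr0 hrt, one_mul]

end Glue

section GlueR3

/-- `C(ρ; t, x) ≤ B` as soon as `C(ρ; t - h, x) ≤ B` for all small `h > 0`. [folklore] -/
theorem cknC_le_of_pastShift {u : ℝ → EuclideanSpace ℝ (Fin 3) → EuclideanSpace ℝ (Fin 3)}
    {ρ η : ℝ} (hρ : 0 < ρ) (hη : 0 < η) (z : ℝ × EuclideanSpace ℝ (Fin 3)) {B : ℝ≥0∞}
    (h : ∀ h', 0 < h' → h' < η → cknC ρ (z.1 - h', z.2) u ≤ B) : cknC ρ z u ≤ B :=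
  scaledSetLIntegral_le_of_pastShift (f := fun w => ‖u w.1 w.2‖ₑ ^ (3 : ℕ)) hρ hη z h

/-- `D(ρ; t, x) ≤ B` as soon as `D(ρ; t - h, x) ≤ B` for all small `h > 0`. [folklore] -/
theorem cknD_le_of_pastShift {p : ℝ → EuclideanSpace ℝ (Fin 3) → ℝ} {ρ η : ℝ} (hρ : 0 < ρ)
    (hη : 0 < η) (z : ℝ × EuclideanSpace ℝ (Fin 3)) {B : ℝ≥0∞}
    (h : ∀ h', 0 < h' → h' < η → cknD ρ (z.1 - h', z.2) p ≤ B) : cknD ρ z p ≤ B :=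
  scaledSetLIntegral_le_of_pastShift (f := fun w => ‖p w.1 w.2‖ₑ ^ (3 / 2 : ℝ)) hρ hη z h

/-- **The dissipation at a centre shifted into the past**: `E(s; t - h, x) ≤ 2 E(2s; t, x)` for
`0 ≤ h ≤ s²` (`Q_s(t - h, x) ⊆ Q_{2s}(t, x)`). [folklore] -/
theorem cknE_pastShift_le {s h : ℝ} (hs : 0 < s) (h0 : 0 ≤ h) (hh : h ≤ s ^ 2)
    (z : ℝ × EuclideanSpace ℝ (Fin 3))
    (G : ℝ → EuclideanSpace ℝ (Fin 3) → EuclideanSpace ℝ (Fin 3) →L[ℝ] EuclideanSpace ℝ (Fin 3)) :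
    cknE s (z.1 - h, z.2) G ≤ 2 * cknE (2 * s) z G := by
  have h2s : ENNReal.ofReal (2 * s) = 2 * ENNReal.ofReal s := by
    rw [ENNReal.ofReal_mul (by norm_num : (0 : ℝ) ≤ 2), ENNReal.ofReal_ofNat]
  calc cknE s (z.1 - h, z.2) G
      ≤ (ENNReal.ofReal s)⁻¹ * ∫⁻ q in parabolicCylinder (2 * s) z,
          ENNReal.ofReal (frobeniusNormSq (G q.1 q.2)) :=
        mul_le_mul_right
          (lintegral_mono_set (parabolicCylinder_pastShift_subset_double hs.le h0 hh z)) _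
    _ = 2 * cknE (2 * s) z G := by
        rw [cknE, h2s, ENNReal.mul_inv (Or.inl two_ne_zero) (Or.inl ENNReal.ofNat_ne_top),
          ← mul_assoc, ← mul_assoc, ENNReal.mul_inv_cancel two_ne_zero ENNReal.ofNat_ne_top,
          one_mul]

/-- From the ball form of the energy class of `IsSuitableWeakSolutionInBall`
(`∫_{B(x,R)} |u(t)|² ≤ C` for a.e. `t ∈ (t₀ - R², t₀)`) to the indicator form used by CKN's
setting and by Lemarié-Rieusset's Thm. 14.4 (`∫ 1_{Q_R} |u|²(t, ·) ≤ C` for a.e. `t`). [folklore] -/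
theorem ae_lintegral_indicator_parabolicCylinder_le
    {u : ℝ → EuclideanSpace ℝ (Fin 3) → EuclideanSpace ℝ (Fin 3)} {C : ℝ≥0∞} {R : ℝ}
    {z : ℝ × EuclideanSpace ℝ (Fin 3)}
    (h : ∀ᵐ t ∂(volume.restrict (Ioo (z.1 - R ^ 2) z.1)), ∫⁻ x in ball z.2 R, ‖u t x‖ₑ ^ 2 ≤ C) :
    ∀ᵐ t : ℝ, ∫⁻ x, (parabolicCylinder R z).indicator (fun w => ‖u w.1 w.2‖ₑ ^ 2) (t, x) ≤ C := by
  rw [ae_restrict_iff' measurableSet_Ioo] at h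
  filter_upwards [h] with t ht
  by_cases htI : t ∈ Ioo (z.1 - R ^ 2) z.1
  · have heq : ∀ x, (parabolicCylinder R z).indicator (fun w => ‖u w.1 w.2‖ₑ ^ 2) (t, x) =
        (ball z.2 R).indicator (fun x => ‖u t x‖ₑ ^ 2) x := by
      intro x
      by_cases hx : x ∈ ball z.2 R
      · rw [indicator_of_mem (show (t, x) ∈ parabolicCylinder R z from mk_mem_prod htI hx),
          indicator_of_mem hx]
      · rw [indicator_of_notMem (fun hw : (t, x) ∈ parabolicCylinder R z => hx hw.2),
          indicator_of_notMem hx]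
    simp_rw [heq]
    rw [lintegral_indicator measurableSet_ball]
    exact ht htI
  · have heq : ∀ x, (parabolicCylinder R z).indicator (fun w => ‖u w.1 w.2‖ₑ ^ 2) (t, x) = 0 :=
      fun x => indicator_of_notMem (fun hw : (t, x) ∈ parabolicCylinder R z => htI hw.1) _
    simp_rw [heq, lintegral_zero]
    exact bot_le

/-- The scaled force quantity of the zero force vanishes (`q > 0`) (private copy of
`cknF_zero_force`, `TsaiLocalEnergyProofs.lean`, not imported here). [folklore] -/
private theorem cknF_zero_force' {q : ℝ} (hq : 0 < q) (r : ℝ) (z : ℝ × EuclideanSpace ℝ (Fin 3)) :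
    cknF q r z (0 : ℝ → EuclideanSpace ℝ (Fin 3) → EuclideanSpace ℝ (Fin 3)) = 0 := by
  simp [cknF, ENNReal.zero_rpow_of_pos hq]

/-- Backward parabolic cylinders of positive radius are connected (convex and nonempty), hence
"domains" for Lemarié-Rieusset's Thm. 14.4 (private copy of `isConnected_parabolicCylinder`,
`TsaiLocalEnergyProofs.lean`, not imported here). [folklore] -/
private theorem isConnected_parabolicCylinder' {r : ℝ} (hr : 0 < r)
    (z : ℝ × EuclideanSpace ℝ (Fin 3)) : IsConnected (parabolicCylinder r z) := by
  refine ⟨⟨(z.1 - r ^ 2 / 2, z.2), ?_⟩, ((convex_Ioo _ _).prod (convex_ball _ _)).isPreconnected⟩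
  rw [mem_parabolicCylinder, dist_self]
  exact ⟨⟨by nlinarith, by nlinarith⟩, hr⟩

end GlueR3

/-! ### Steps 1–2: the decay scheme at centres shifted into the past -/

/-- **Smallness of `C + D` at the shifted centres** (Seregin 2014, proof of Thm. 1.4, p. 100:
"for sufficiently small `ε` and sufficiently small `r₀`, `C(r₀) + D₀(r₀) < ε₀`", obtained here
by the Lin / Robinson–Rodrigo–Sadowski scheme `CKN1982.decay_scheme` from the local-energy
estimate, the pressure estimate and the proved interpolation inequality). For every target
`ε₀ > 0` there is `ε > 0` such that for every suitable weak solution `(u, p)` in `Q(z, 1)`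
(`IsSuitableWeakSolutionInBall 1 z`, `z = (t, x)`) with a weak gradient `G` satisfying
`sup_{0<r<1} E(r; z) < ε` there is a radius `ρ ∈ (0, 1/4]` with
`C(ρ; z_h) + D(ρ; z_h) ≤ ε₀` at **every** centre `z_h = (t - h, x)`, `0 < h ≤ ρ²`
(`C = cknC`, `D = cknD`; the radius does not depend on `h`). [cite: Seregin2014, Ch. 6 §6.1 proof of Theorem 1.4, (6.1.44)–(6.1.52), PDF pp. 98–100] -/
theorem seregin2014_shifted_smallness_of_estimates (hLE : localEnergyEstimate)
    (hPE : pressureEstimate) {ε₀ : ℝ} (hε₀ : 0 < ε₀) :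
    ∃ ε : ℝ, 0 < ε ∧ ∀ z u p, IsSuitableWeakSolutionInBall 1 z u p →
      (∃ G, HasWeakSpatialGradientOn (parabolicCylinderOpens 1 z) u G ∧
        (⨆ r ∈ Ioo (0 : ℝ) 1, cknE r z G) < ENNReal.ofReal ε) →
      ∃ ρ : ℝ, 0 < ρ ∧ ρ ≤ 1 / 4 ∧ ∀ h : ℝ, 0 < h → h ≤ ρ ^ 2 →
        cknC ρ (z.1 - h, z.2) u + cknD ρ (z.1 - h, z.2) p ≤ ENNReal.ofReal ε₀ := by
  obtain ⟨κ₁, κ₂, κ₃, κ₄, hLE⟩ := hLE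
  obtain ⟨κ₅, κ₆, hPE⟩ := hPE
  obtain ⟨C₀, hIE⟩ := interpolationEstimate_holds
  -- the abstract scheme with the real constants
  obtain ⟨θ, hθ, hθhalf, hscheme⟩ := CKN1982.decay_scheme (κ₁ := (κ₁ : ℝ)) (κ₂ := (κ₂ : ℝ))
    (κ₃ := (κ₃ : ℝ)) (κ₄ := (κ₄ : ℝ))
    (κ₅ := (2 : ℝ) ^ (1 / 3 : ℝ) * (κ₅ : ℝ) ^ (4 / 3 : ℝ))
    (κ₆ := (2 : ℝ) ^ (1 / 3 : ℝ) * (κ₆ : ℝ) ^ (4 / 3 : ℝ)) (C₀ := (C₀ : ℝ))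
    κ₁.coe_nonneg κ₂.coe_nonneg κ₃.coe_nonneg κ₄.coe_nonneg (by positivity) (by positivity)
    C₀.coe_nonneg
  have hθ1 : θ ≤ 1 := hθhalf.trans (by norm_num)
  obtain ⟨ε, hε, η, hη, hsteps⟩ := hscheme ε₀ hε₀
  refine ⟨ε / 2, half_pos hε, fun z u p hIB hGsup => ?_⟩
  obtain ⟨G, hG, hsup⟩ := hGsup
  obtain ⟨hsws, ⟨CK, hCK⟩, -, hpLp⟩ := hIB
  -- the domain `Q = Q(z, 1)` and the data
  set Q := parabolicCylinderOpens 1 z with hQdef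
  have hQ : (Q : Set (ℝ × EuclideanSpace ℝ (Fin 3))) = parabolicCylinder 1 z := rfl
  have hCK' : ∀ᵐ t : ℝ, ∫⁻ x, (Q : Set (ℝ × EuclideanSpace ℝ (Fin 3))).indicator
      (fun w => ‖u w.1 w.2‖ₑ ^ 2) (t, x) ≤ CK := by
    rw [hQ]
    exact ae_lintegral_indicator_parabolicCylinder_le hCK
  have hNp : ∫⁻ w in (Q : Set (ℝ × EuclideanSpace ℝ (Fin 3))), ‖p w.1 w.2‖ₑ ^ (3 / 2 : ℝ) < ∞ := by
    have := hpLp.2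
    rw [eLpNorm_lt_top_iff_lintegral_rpow_enorm_lt_top (by norm_num)
      (by simp [ENNReal.div_eq_top])] at this
    have e32 : ((3 : ℝ≥0∞) / 2).toReal = (3 / 2 : ℝ) := by
      rw [ENNReal.toReal_div, ENNReal.toReal_ofNat, ENNReal.toReal_ofNat]
    rw [e32] at this
    exact this
  have hf0 : MemLp (uncurry (0 : ℝ → EuclideanSpace ℝ (Fin 3) → EuclideanSpace ℝ (Fin 3)))
      (ENNReal.ofReal 3) (volume.restrict (Q : Set (ℝ × EuclideanSpace ℝ (Fin 3)))) :=
    MemLp.zero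
  have hfli := locallyIntegrableOn_of_memLp (by norm_num) hf0
  -- the starting scale `r₀ = 1/4`, the a-priori bound `M` and the number of steps `k`
  set r₀ : ℝ := 1 / 4 with hr₀def
  have hr₀ : 0 < r₀ := by norm_num
  obtain ⟨k, hk⟩ := hsteps
    (((ENNReal.ofReal r₀)⁻¹ * CK).toReal +
      ((((ENNReal.ofReal r₀) ^ 2)⁻¹ *
        ∫⁻ w in (Q : Set (ℝ × EuclideanSpace ℝ (Fin 3))), ‖p w.1 w.2‖ₑ ^ (3 / 2 : ℝ)) ^
          (4 / 3 : ℝ)).toReal)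
  -- the last scale `ρ`
  obtain ⟨ρ, hρdef⟩ : ∃ ρ : ℝ, ρ = θ ^ k * r₀ := ⟨_, rfl⟩
  have hρ : 0 < ρ := by rw [hρdef]; positivity
  have hρr₀ : ρ ≤ r₀ := by
    rw [hρdef]; exact mul_le_of_le_one_left hr₀.le (pow_le_one₀ hθ.le hθ1)
  refine ⟨ρ, hρ, hρr₀, fun h hh hhρ => ?_⟩
  -- the shifted centre
  set z' := (z.1 - h, z.2) with hz'
  -- the scales `s j = θʲ r₀`
  have hs0 : ∀ j : ℕ, 0 < θ ^ j * r₀ := fun j => by positivity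
  have hsr₀ : ∀ j : ℕ, θ ^ j * r₀ ≤ r₀ := fun j =>
    mul_le_of_le_one_left hr₀.le (pow_le_one₀ hθ.le hθ1)
  have hsρ : ∀ j ≤ k, ρ ≤ θ ^ j * r₀ := fun j hj => by
    rw [hρdef]
    exact mul_le_mul_of_nonneg_right (pow_le_pow_of_le_one hθ.le hθ1 hj) hr₀.le
  have hsucc : ∀ j : ℕ, θ * (θ ^ j * r₀) = θ ^ (j + 1) * r₀ := fun j => by rw [pow_succ]; ring
  -- inclusions for every admissible radius
  have hhr₀ : h ≤ r₀ ^ 2 := hhρ.trans (pow_le_pow_left₀ hρ.le hρr₀ 2)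
  have hclQ : ∀ r, 0 < r → r ≤ r₀ →
      closure (parabolicCylinder r z') ⊆ (Q : Set (ℝ × EuclideanSpace ℝ (Fin 3))) := by
    intro r hr hrr
    rw [hQ, hz']
    refine closure_parabolicCylinder_pastShift_subset hh (by rw [hr₀def] at hrr; linarith) ?_ _
    have : r ^ 2 ≤ r₀ ^ 2 := pow_le_pow_left₀ hr.le hrr 2
    rw [hr₀def] at this hhr₀
    nlinarith
  have hsubQ : ∀ r, 0 < r → r ≤ r₀ →
      parabolicCylinder r z' ⊆ (Q : Set (ℝ × EuclideanSpace ℝ (Fin 3))) :=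
    fun r hr hrr => subset_closure.trans (hclQ r hr hrr)
  -- finiteness of the scaled quantities at admissible radii
  have hAfin : ∀ r, 0 < r → r ≤ r₀ → cknAEss r z' u ≠ ∞ := fun r hr hrr =>
    ne_top_of_le_ne_top (ENNReal.mul_ne_top (ENNReal.inv_ne_top.2 (ENNReal.ofReal_pos.2 hr).ne')
      ENNReal.coe_ne_top) (cknAEss_le_of_energy hCK' (hsubQ r hr hrr))
  have hDfin : ∀ r, 0 < r → r ≤ r₀ → cknD r z' p ≠ ∞ := fun r hr hrr =>
    ne_top_of_le_ne_top (ENNReal.mul_ne_top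
      (ENNReal.inv_ne_top.2 (pow_ne_zero 2 (ENNReal.ofReal_pos.2 hr).ne')) hNp.ne)
      (cknD_le_of_subset p (hsubQ r hr hrr))
  have hGr : ∀ r, 0 < r → r ≤ r₀ → HasWeakSpatialGradientOn (parabolicCylinderOpens r z') u G :=
    fun r hr hrr => hG.mono (hsubQ r hr hrr)
  -- the dissipation at the scales: `E(s_j; z') ≤ 2 E(2 s_j; z) < ε`
  have hEsc : ∀ j ≤ k, cknE (θ ^ j * r₀) z' G ≤ ENNReal.ofReal ε := by
    intro j hj
    have hs := hs0 j
    have h2s1 : 2 * (θ ^ j * r₀) < 1 := by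
      have := hsr₀ j; rw [hr₀def] at this ⊢; linarith
    have hle : h ≤ (θ ^ j * r₀) ^ 2 := hhρ.trans (pow_le_pow_left₀ hρ.le (hsρ j hj) 2)
    calc cknE (θ ^ j * r₀) z' G ≤ 2 * cknE (2 * (θ ^ j * r₀)) z G :=
          cknE_pastShift_le hs hh.le hle z G
      _ ≤ 2 * ⨆ r ∈ Ioo (0 : ℝ) 1, cknE r z G := by
          gcongr
          exact le_iSup₂ (f := fun r (_ : r ∈ Ioo (0 : ℝ) 1) => cknE r z G)
            (2 * (θ ^ j * r₀)) ⟨by positivity, h2s1⟩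
      _ ≤ 2 * ENNReal.ofReal (ε / 2) := by gcongr
      _ = ENNReal.ofReal ε := by
          rw [two_mul, ← ENNReal.ofReal_add (by positivity) (by positivity), add_halves]
  have hEfin : ∀ j ≤ k, cknE (θ ^ j * r₀) z' G ≠ ∞ := fun j hj =>
    ((hEsc j hj).trans_lt ENNReal.ofReal_lt_top).ne
  have hCfin : cknC (θ ^ k * r₀) z' u ≠ ∞ :=
    ne_top_of_le_ne_top (ENNReal.mul_ne_top ENNReal.coe_ne_top (ENNReal.rpow_ne_top_of_nonneg
      (by norm_num) (ENNReal.add_ne_top.2 ⟨hAfin _ (hs0 k) (hsr₀ k), hEfin k le_rfl⟩)))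
      (hIE u G z' (θ ^ k * r₀) (hs0 k) (hGr _ (hs0 k) (hsr₀ k)) (hAfin _ (hs0 k) (hsr₀ k))
        (hEfin k le_rfl))
  -- the force quantities vanish
  have hF0 : ∀ r, cknF 3 r z' (0 : ℝ → EuclideanSpace ℝ (Fin 3) → EuclideanSpace ℝ (Fin 3)) = 0 :=
    fun r => cknF_zero_force' three_pos r z'
  -- the real sequences and the scheme
  have hmain := hk (fun j => (cknAEss (θ ^ j * r₀) z' u).toReal)
    (fun j => (cknE (θ ^ j * r₀) z' G).toReal)
    (fun j => (cknD (θ ^ j * r₀) z' p ^ (4 / 3 : ℝ)).toReal)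
    (fun j => (cknF 3 (θ ^ j * r₀) z'
      (0 : ℝ → EuclideanSpace ℝ (Fin 3) → EuclideanSpace ℝ (Fin 3)) ^ (2 / 3 : ℝ)).toReal)
    ((cknC (θ ^ k * r₀) z' u).toReal)
    (fun j => ENNReal.toReal_nonneg) (fun j => ENNReal.toReal_nonneg)
    (fun j => ENNReal.toReal_nonneg) (fun j => ENNReal.toReal_nonneg) ENNReal.toReal_nonneg
    (fun j hj => by
      -- local-energy estimate at `(s j, θ)`
      have H := hLE Q 3 0 u p G hsws (by norm_num) hf0 hG z' (θ ^ j * r₀) θ (hs0 j) hθ hθhalf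
        (hclQ _ (hs0 j) (hsr₀ j))
      rw [hsucc j] at H
      exact real_localEnergy le_self_add H three_pos (hAfin _ (hs0 j) (hsr₀ j))
        (hEfin j hj.le) (hDfin _ (hs0 j) (hsr₀ j)) (by rw [hF0]; exact ENNReal.zero_ne_top))
    (fun j hj => by
      -- pressure estimate at `(s j, θ)`
      have H := hPE Q 0 u p G hsws hfli (fun φ _ => by simp) hG z' (θ ^ j * r₀) θ (hs0 j) hθ
        hθhalf (hclQ _ (hs0 j) (hsr₀ j))
      rw [hsucc j] at H
      exact real_pressure hθ hθ1 H (hAfin _ (hs0 j) (hsr₀ j)) (hEfin j hj.le)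
        (hDfin _ (hs0 j) (hsr₀ j)))
    (by
      -- interpolation at the last scale
      exact real_interpolation (hIE u G z' (θ ^ k * r₀) (hs0 k) (hGr _ (hs0 k) (hsr₀ k))
        (hAfin _ (hs0 k) (hsr₀ k)) (hEfin k le_rfl)) (hAfin _ (hs0 k) (hsr₀ k))
        (hEfin k le_rfl))
    (fun j hj => ENNReal.toReal_le_of_le_ofReal hε.le (hEsc j hj))
    (fun j hj => by
      -- force smallness (void)
      refine real_force three_pos hη.le ?_
      rw [hF0]
      exact bot_le)
    (by
      -- the a-priori bound at `r₀`
      have e0 : θ ^ 0 * r₀ = r₀ := by simp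
      simp only [e0]
      have hA0 : cknAEss r₀ z' u ≤ (ENNReal.ofReal r₀)⁻¹ * CK :=
        cknAEss_le_of_energy hCK' (hsubQ r₀ hr₀ le_rfl)
      have hD0 : cknD r₀ z' p ^ (4 / 3 : ℝ) ≤ (((ENNReal.ofReal r₀) ^ 2)⁻¹ *
          ∫⁻ w in (Q : Set (ℝ × EuclideanSpace ℝ (Fin 3))), ‖p w.1 w.2‖ₑ ^ (3 / 2 : ℝ)) ^
            (4 / 3 : ℝ) :=
        ENNReal.rpow_le_rpow (cknD_le_of_subset p (hsubQ r₀ hr₀ le_rfl)) (by norm_num)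
      have hfinA : (ENNReal.ofReal r₀)⁻¹ * (CK : ℝ≥0∞) ≠ ∞ :=
        ENNReal.mul_ne_top (ENNReal.inv_ne_top.2 (ENNReal.ofReal_pos.2 hr₀).ne')
          ENNReal.coe_ne_top
      have hfinD : (((ENNReal.ofReal r₀) ^ 2)⁻¹ *
          ∫⁻ w in (Q : Set (ℝ × EuclideanSpace ℝ (Fin 3))), ‖p w.1 w.2‖ₑ ^ (3 / 2 : ℝ)) ^
            (4 / 3 : ℝ) ≠ ∞ :=
        ENNReal.rpow_ne_top_of_nonneg (by norm_num) (ENNReal.mul_ne_top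
          (ENNReal.inv_ne_top.2 (pow_ne_zero 2 (ENNReal.ofReal_pos.2 hr₀).ne')) hNp.ne)
      exact add_le_add (ENNReal.toReal_mono hfinA hA0) (ENNReal.toReal_mono hfinD hD0))
  -- back to `ℝ≥0∞`: `C(ρ) + D(ρ) ≤ ε₀` at the shifted centre
  beta_reduce at hmain
  rw [← hρdef] at hmain
  have hCfin' : cknC ρ z' u ≠ ∞ := by rw [hρdef]; exact hCfin
  exact add_le_ofReal_of_real hCfin' (hDfin ρ hρ hρr₀) hmain

/-! ### Step 3: smallness at the vertex -/

/-- **Smallness of `C + D` at the vertex** (Seregin 2014, proof of Thm. 1.4, p. 100, in the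
tree's vocabulary): for every `ε₀ > 0` there is `ε > 0` such that every suitable weak solution
`(u, p)` in `Q(z, 1)` with `sup_{0<r<1} E(r; z) < ε` has `C(ρ; z) + D(ρ; z) ≤ ε₀` for some
`ρ ∈ (0, 1/4]` — from `seregin2014_shifted_smallness_of_estimates` by continuity from below as
`h → 0⁺`. [cite: Seregin2014, Ch. 6 §6.1 proof of Theorem 1.4, PDF p. 100] -/
theorem seregin2014_vertex_smallness_of_estimates (hLE : localEnergyEstimate)
    (hPE : pressureEstimate) {ε₀ : ℝ} (hε₀ : 0 < ε₀) :
    ∃ ε : ℝ, 0 < ε ∧ ∀ z u p, IsSuitableWeakSolutionInBall 1 z u p →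
      (∃ G, HasWeakSpatialGradientOn (parabolicCylinderOpens 1 z) u G ∧
        (⨆ r ∈ Ioo (0 : ℝ) 1, cknE r z G) < ENNReal.ofReal ε) →
      ∃ ρ : ℝ, 0 < ρ ∧ ρ ≤ 1 / 4 ∧ cknC ρ z u + cknD ρ z p ≤ ENNReal.ofReal ε₀ := by
  obtain ⟨ε, hε, H⟩ := seregin2014_shifted_smallness_of_estimates hLE hPE (half_pos hε₀)
  refine ⟨ε, hε, fun z u p hIB hGsup => ?_⟩
  obtain ⟨ρ, hρ, hρ4, hsmall⟩ := H z u p hIB hGsup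
  refine ⟨ρ, hρ, hρ4, ?_⟩
  have hρ2 : 0 < ρ ^ 2 := by positivity
  have hC : cknC ρ z u ≤ ENNReal.ofReal (ε₀ / 2) :=
    cknC_le_of_pastShift hρ hρ2 z fun h' hh' hh'η => le_self_add.trans (hsmall h' hh' hh'η.le)
  have hD : cknD ρ z p ≤ ENNReal.ofReal (ε₀ / 2) :=
    cknD_le_of_pastShift hρ hρ2 z fun h' hh' hh'η => le_add_self.trans (hsmall h' hh' hh'η.le)
  calc cknC ρ z u + cknD ρ z p
      ≤ ENNReal.ofReal (ε₀ / 2) + ENNReal.ofReal (ε₀ / 2) := add_le_add hC hD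
    _ = ENNReal.ofReal ε₀ := by
        rw [← ENNReal.ofReal_add (by positivity) (by positivity), add_halves]

/-! ### Step 4: Theorem 1.4 from the leaves -/

/-- **Seregin 2014, Ch. 6, Theorem 1.4 from the tree's Caffarelli–Kohn–Nirenberg leaves.** The
named fact `seregin2014_thm14` (ε-regularity at the vertex of the backward cylinder `Q(0, 1)`
under `sup_{0<r<1} E(r) < ε`) follows from the local-energy estimate `localEnergyEstimate`
(Robinson–Rodrigo–Sadowski 2016, (16.13); Seregin's Lemma 6.3), the pressure estimate
`pressureEstimate` (ibid., Lemma 16.7; Seregin's Lemma 6.4), the proved interpolation inequality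
`interpolationEstimate_holds` (Seregin's Lemma 6.2) and Lemarié-Rieusset's one-scale criterion
`lemarieRieusset_epsilon_regularity` (Thm. 14.4; Seregin's Lemma 6.1), the latter applied with
`ν = 1`, `q = 3`, `f = 0`, `λ = ε₁` on the domain `Ω = Q(0, 1)` at `z₀ = 0`, `r₀ = ρ`, once
`C(ρ; 0) + D(ρ; 0) ≤ ε₁³` (`seregin2014_vertex_smallness_of_estimates`): `|u| ≤ C₀ ε₁ / ρ` a.e.
on `Q_{ρ/2}(0)`, so `u ∈ L^∞(Q(ϱ))` with `ϱ = ρ/2 ∈ (0, 1)`. [cite: Seregin2014, Ch. 6 §6.1 Theorem 1.4 and its proof, PDF pp. 94–100] -/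
theorem seregin2014_thm14_of_estimates (hLE : localEnergyEstimate) (hPE : pressureEstimate)
    (hLR : lemarieRieusset_epsilon_regularity) : seregin2014_thm14 := by
  obtain ⟨ε₁, C₀, hε₁, -, H⟩ := hLR 1 3 one_pos (by norm_num)
  obtain ⟨ε, hε, hV⟩ := seregin2014_vertex_smallness_of_estimates hLE hPE (ε₀ := ε₁ ^ 3)
    (by positivity)
  refine ⟨ε, hε, fun u p hIB hGsup => ?_⟩
  obtain ⟨ρ, hρ, hρ4, hsmall⟩ := hV 0 u p hIB hGsup
  obtain ⟨hsws, ⟨Cu, hCu⟩, ⟨G₀, hG₀, hG₀L2⟩, hpLp⟩ := hIB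
  -- the domain `Ω = Q(0, 1)`
  set Ω := parabolicCylinderOpens 1 (0 : ℝ × EuclideanSpace ℝ (Fin 3)) with hΩdef
  have hΩ : (Ω : Set (ℝ × EuclideanSpace ℝ (Fin 3))) = parabolicCylinder 1 0 := rfl
  -- the data of the suitable weak solution
  obtain ⟨G, hG, -, hLEI⟩ := hsws.localEnergy
  -- the eight hypotheses of Thm. 14.4 on `Ω`
  have hconn : IsConnected (Ω : Set (ℝ × EuclideanSpace ℝ (Fin 3))) :=
    isConnected_parabolicCylinder' one_pos _
  have hE : ∃ C : ℝ≥0, ∀ᵐ t : ℝ, ∫⁻ x, (Ω : Set (ℝ × EuclideanSpace ℝ (Fin 3))).indicator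
      (fun w => ‖u w.1 w.2‖ₑ ^ 2) (t, x) ≤ C :=
    ⟨Cu, by rw [hΩ]; exact ae_lintegral_indicator_parabolicCylinder_le hCu⟩
  have hGsq : ∫⁻ w in (Ω : Set (ℝ × EuclideanSpace ℝ (Fin 3))),
      ENNReal.ofReal (frobeniusNormSq (G w.1 w.2)) < ∞ := by
    have hae := hG₀.ae_eq hG
    calc ∫⁻ w in (Ω : Set (ℝ × EuclideanSpace ℝ (Fin 3))),
          ENNReal.ofReal (frobeniusNormSq (G w.1 w.2))
        = ∫⁻ w in (Ω : Set (ℝ × EuclideanSpace ℝ (Fin 3))),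
            ENNReal.ofReal (frobeniusNormSq (G₀ w.1 w.2)) := by
          refine lintegral_congr_ae ?_
          filter_upwards [hae] with w hw
          change ENNReal.ofReal (frobeniusNormSq (uncurry G w)) =
            ENNReal.ofReal (frobeniusNormSq (uncurry G₀ w))
          rw [hw]
      _ < ∞ := hG₀L2
  have hP : ∫⁻ w in (Ω : Set (ℝ × EuclideanSpace ℝ (Fin 3))), ‖p w.1 w.2‖ₑ ^ (3 / 2 : ℝ) < ∞ := by
    have := hpLp.2
    rw [eLpNorm_lt_top_iff_lintegral_rpow_enorm_lt_top (by norm_num)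
      (by simp [ENNReal.div_eq_top])] at this
    have e32 : ((3 : ℝ≥0∞) / 2).toReal = (3 / 2 : ℝ) := by
      rw [ENNReal.toReal_div, ENNReal.toReal_ofNat, ENNReal.toReal_ofNat]
    rw [e32] at this
    exact this
  have hf : MemLp (uncurry (0 : ℝ → EuclideanSpace ℝ (Fin 3) → EuclideanSpace ℝ (Fin 3)))
      (ENNReal.ofReal 3) (volume.restrict (Ω : Set (ℝ × EuclideanSpace ℝ (Fin 3)))) :=
    MemLp.zero
  have hdist : IsDistributionalNSSolutionOn Ω 1 0 u p := hsws.distributional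
  -- smallness in the form (14.17) with `λ = ε₁`
  have hsub : parabolicCylinder ρ 0 ⊆ (Ω : Set (ℝ × EuclideanSpace ℝ (Fin 3))) := by
    rw [hΩ]; exact parabolicCylinder_mono hρ.le (hρ4.trans (by norm_num)) _
  have hum : AEMeasurable (fun w : ℝ × EuclideanSpace ℝ (Fin 3) => ‖u w.1 w.2‖ₑ ^ (3 : ℕ))
      (volume.restrict (parabolicCylinder ρ 0)) := by
    have h1 := (hsws.distributional.1.aestronglyMeasurable).mono_measure
      (Measure.restrict_mono hsub le_rfl)
    exact h1.aemeasurable.enorm.pow_const 3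
  have hr2_0 : ENNReal.ofReal ρ ^ 2 ≠ 0 := pow_ne_zero _ (ENNReal.ofReal_pos.2 hρ).ne'
  have hr2_t : ENNReal.ofReal ρ ^ 2 ≠ ∞ := ENNReal.pow_ne_top ENNReal.ofReal_ne_top
  have hUP : ∫⁻ w in parabolicCylinder ρ (0 : ℝ × EuclideanSpace ℝ (Fin 3)),
      (‖u w.1 w.2‖ₑ ^ (3 : ℕ) + ‖p w.1 w.2‖ₑ ^ (3 / 2 : ℝ)) ≤ ENNReal.ofReal (ε₁ ^ 3 * ρ ^ 2) := by
    set I : ℝ≥0∞ := ∫⁻ w in parabolicCylinder ρ (0 : ℝ × EuclideanSpace ℝ (Fin 3)),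
      (‖u w.1 w.2‖ₑ ^ (3 : ℕ) + ‖p w.1 w.2‖ₑ ^ (3 / 2 : ℝ)) with hI
    have h1 : (ENNReal.ofReal ρ ^ 2)⁻¹ * I ≤ ENNReal.ofReal (ε₁ ^ 3) := by
      rw [hI, lintegral_add_left' hum, mul_add]
      exact hsmall
    calc I = (ENNReal.ofReal ρ ^ 2 * (ENNReal.ofReal ρ ^ 2)⁻¹) * I := by
          rw [ENNReal.mul_inv_cancel hr2_0 hr2_t, one_mul]
      _ = ENNReal.ofReal ρ ^ 2 * ((ENNReal.ofReal ρ ^ 2)⁻¹ * I) := mul_assoc _ _ _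
      _ ≤ ENNReal.ofReal ρ ^ 2 * ENNReal.ofReal (ε₁ ^ 3) := mul_le_mul_right h1 _
      _ = ENNReal.ofReal (ε₁ ^ 3 * ρ ^ 2) := by
          rw [← ENNReal.ofReal_pow hρ.le, ← ENNReal.ofReal_mul (by positivity), mul_comm]
  have hF : ∫⁻ w in parabolicCylinder ρ (0 : ℝ × EuclideanSpace ℝ (Fin 3)),
      ‖(0 : ℝ → EuclideanSpace ℝ (Fin 3) → EuclideanSpace ℝ (Fin 3)) w.1 w.2‖ₑ ^ (3 : ℝ) ≤
      ENNReal.ofReal (ε₁ ^ (2 * (3 : ℝ)) * ρ ^ (5 - 3 * (3 : ℝ))) := by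
    simp [ENNReal.zero_rpow_of_pos (by norm_num : (0 : ℝ) < 3)]
  -- Thm. 14.4 on `Ω` at `(0, ρ, λ = ε₁)`
  have key := H Ω 0 u p G hconn hE hG hGsq hP hf hdist hLEI 0 ρ ε₁ hρ hsub hε₁.le le_rfl hUP hF
  refine ⟨ρ / 2, ⟨by positivity, by linarith⟩, ?_⟩
  rw [eLpNorm_exponent_top]
  exact eLpNormEssSup_lt_top_of_ae_bound key

/-- **Theorem 1.4 over the two open leaves.** With the local-energy estimate discharged in the
tree (`localEnergyEstimate_holds`, `CKNLocalEnergyEstimate.lean`; Robinson–Rodrigo–Sadowski 2016,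
(16.13)) and the interpolation inequality proved (`interpolationEstimate_holds`), Seregin's
Theorem 1.4 (`seregin2014_thm14`) is reduced to the pressure estimate `pressureEstimate`
(Robinson–Rodrigo–Sadowski 2016, Lemma 16.7; Seregin's Lemma 6.4) and Lemarié-Rieusset's
one-scale criterion `lemarieRieusset_epsilon_regularity` (Thm. 14.4; Seregin's Lemma 6.1). [cite: Seregin2014, Ch. 6 §6.1 Theorem 1.4, PDF p. 94] -/
theorem seregin2014_thm14_of_pressureEstimate_of_lemarieRieusset (hPE : pressureEstimate)
    (hLR : lemarieRieusset_epsilon_regularity) : seregin2014_thm14 :=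
  seregin2014_thm14_of_estimates localEnergyEstimate_holds hPE hLR

/-! ### The unforced route: Theorem 1.4 over `pressureEstimate` and RRS Thm. 15.3 -/

/-- From `C(ρ; z) + D(ρ; z) ≤ Λ` to the one-scale smallness in the form (14.17),
`∫∫_{Q_ρ(z)} (|u|³ + |p|^{3/2}) ≤ Λ ρ²` (`C = cknC`, `D = cknD`). [folklore] -/
theorem setLIntegral_cubic_add_pressure_le_of_cknC_add_cknD_le
    {u : ℝ → EuclideanSpace ℝ (Fin 3) → EuclideanSpace ℝ (Fin 3)}
    {p : ℝ → EuclideanSpace ℝ (Fin 3) → ℝ} {ρ Λ : ℝ} (hρ : 0 < ρ)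
    {z : ℝ × EuclideanSpace ℝ (Fin 3)}
    (hum : AEMeasurable (fun w : ℝ × EuclideanSpace ℝ (Fin 3) => ‖u w.1 w.2‖ₑ ^ (3 : ℕ))
      (volume.restrict (parabolicCylinder ρ z)))
    (h : cknC ρ z u + cknD ρ z p ≤ ENNReal.ofReal Λ) :
    ∫⁻ w in parabolicCylinder ρ z, (‖u w.1 w.2‖ₑ ^ (3 : ℕ) + ‖p w.1 w.2‖ₑ ^ (3 / 2 : ℝ)) ≤
      ENNReal.ofReal (Λ * ρ ^ 2) := by
  have hr2_0 : ENNReal.ofReal ρ ^ 2 ≠ 0 := pow_ne_zero _ (ENNReal.ofReal_pos.2 hρ).ne'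
  have hr2_t : ENNReal.ofReal ρ ^ 2 ≠ ∞ := ENNReal.pow_ne_top ENNReal.ofReal_ne_top
  set I : ℝ≥0∞ := ∫⁻ w in parabolicCylinder ρ z,
    (‖u w.1 w.2‖ₑ ^ (3 : ℕ) + ‖p w.1 w.2‖ₑ ^ (3 / 2 : ℝ)) with hI
  have h1 : (ENNReal.ofReal ρ ^ 2)⁻¹ * I ≤ ENNReal.ofReal Λ := by
    rw [hI, lintegral_add_left' hum, mul_add]
    exact h
  calc I = (ENNReal.ofReal ρ ^ 2 * (ENNReal.ofReal ρ ^ 2)⁻¹) * I := by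
        rw [ENNReal.mul_inv_cancel hr2_0 hr2_t, one_mul]
    _ = ENNReal.ofReal ρ ^ 2 * ((ENNReal.ofReal ρ ^ 2)⁻¹ * I) := mul_assoc _ _ _
    _ ≤ ENNReal.ofReal ρ ^ 2 * ENNReal.ofReal Λ := mul_le_mul_right h1 _
    _ = ENNReal.ofReal (Λ * ρ ^ 2) := by
        rw [← ENNReal.ofReal_pow hρ.le, ← ENNReal.ofReal_mul (by positivity), mul_comm]

/-- **The global classes of `IsSuitableWeakSolutionInBall 1 z` are the standing hypotheses of
Lemarié-Rieusset's §14.3** (`IsLRSuitableWeakSolutionOn`) on the domain `Ω = Q(z, 1)` with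
`ν = 1` and `f = 0` (any force exponent `q`, the class `0 ∈ L^q` being void): `Ω` is connected;
the ball form of the energy class is the indicator form; the gradient of the local energy
inequality is square integrable because it agrees a.e. with the square-integrable weak gradient
of the definition (`HasWeakSpatialGradientOn.ae_eq`); `p ∈ L^{3/2}(Ω)`. [folklore] -/
theorem IsSuitableWeakSolutionInBall.exists_isLRSuitableWeakSolutionOn
    {z : ℝ × EuclideanSpace ℝ (Fin 3)}
    {u : ℝ → EuclideanSpace ℝ (Fin 3) → EuclideanSpace ℝ (Fin 3)}
    {p : ℝ → EuclideanSpace ℝ (Fin 3) → ℝ} (h : IsSuitableWeakSolutionInBall 1 z u p) (q : ℝ) :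
    ∃ G, IsLRSuitableWeakSolutionOn (parabolicCylinderOpens 1 z) 1 q 0 u p G := by
  obtain ⟨hsws, ⟨Cu, hCu⟩, ⟨G₀, hG₀, hG₀L2⟩, hpLp⟩ := h
  obtain ⟨G, hG, -, hLEI⟩ := hsws.localEnergy
  set Ω := parabolicCylinderOpens 1 z with hΩdef
  have hΩ : (Ω : Set (ℝ × EuclideanSpace ℝ (Fin 3))) = parabolicCylinder 1 z := rfl
  refine ⟨G,
    { isConnected := isConnected_parabolicCylinder' one_pos z
      energyClass := ⟨Cu, by rw [hΩ]; exact ae_lintegral_indicator_parabolicCylinder_le hCu⟩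
      weakGradient := hG
      gradient_lt_top := ?_
      pressure_lt_top := ?_
      force_memLp := MemLp.zero
      distributional := hsws.distributional
      localEnergy := hLEI }⟩
  · have hae := hG₀.ae_eq hG
    calc ∫⁻ w in (Ω : Set (ℝ × EuclideanSpace ℝ (Fin 3))),
          ENNReal.ofReal (frobeniusNormSq (G w.1 w.2))
        = ∫⁻ w in (Ω : Set (ℝ × EuclideanSpace ℝ (Fin 3))),
            ENNReal.ofReal (frobeniusNormSq (G₀ w.1 w.2)) := by
          refine lintegral_congr_ae ?_
          filter_upwards [hae] with w hw
          change ENNReal.ofReal (frobeniusNormSq (uncurry G w)) =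
            ENNReal.ofReal (frobeniusNormSq (uncurry G₀ w))
          rw [hw]
      _ < ∞ := hG₀L2
  · have := hpLp.2
    rw [eLpNorm_lt_top_iff_lintegral_rpow_enorm_lt_top (by norm_num)
      (by simp [ENNReal.div_eq_top])] at this
    have e32 : ((3 : ℝ≥0∞) / 2).toReal = (3 / 2 : ℝ) := by
      rw [ENNReal.toReal_div, ENNReal.toReal_ofNat, ENNReal.toReal_ofNat]
    rw [e32] at this
    exact this

/-- **Seregin 2014, Ch. 6, Theorem 1.4 over the pressure estimate and Robinson–Rodrigo–Sadowski's
unforced Thm. 15.3.** The named fact `seregin2014_thm14` follows from `pressureEstimate`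
(Robinson–Rodrigo–Sadowski 2016, Lemma 16.7; Seregin's Lemma 6.4) and `RRS2016.theorem15_3`
(the unforced first local regularity theorem at unit scale, ibid. Thm. 15.3 = Caffarelli–Kohn–
Nirenberg's Prop. 1 = Seregin's Lemma 6.1 for `k = 1`), the local-energy estimate and the
interpolation inequality being theorems of the tree: smallness of `C(ρ; 0) + D(ρ; 0)`
(`seregin2014_vertex_smallness_of_estimates`), then the unforced one-scale criterion
`unforced_epsilonRegularity_of_theorem15_3` on `Ω = Q(0, 1)` at `z₀ = 0`, `r₀ = ρ`, `λ = ε₁`.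
This route avoids the force and the general viscosity of Lemarié-Rieusset's Thm. 14.4, which
Theorem 1.4 (`ν = 1`, `f = 0`) does not need. [cite: Seregin2014, Ch. 6 §6.1 Theorem 1.4 and its proof, PDF pp. 94–100] -/
theorem seregin2014_thm14_of_pressureEstimate_of_theorem15_3 (hPE : pressureEstimate)
    (h153 : RRS2016.theorem15_3) : seregin2014_thm14 := by
  obtain ⟨ε₁, C₀, hε₁, -, H⟩ := unforced_epsilonRegularity_of_theorem15_3 h153
  obtain ⟨ε, hε, hV⟩ := seregin2014_vertex_smallness_of_estimates localEnergyEstimate_holds hPE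
    (ε₀ := ε₁ ^ 3) (by positivity)
  refine ⟨ε, hε, fun u p hIB hGsup => ?_⟩
  obtain ⟨ρ, hρ, hρ4, hsmall⟩ := hV 0 u p hIB hGsup
  obtain ⟨G, hS⟩ := hIB.exists_isLRSuitableWeakSolutionOn 3
  have hsub : parabolicCylinder ρ (0 : ℝ × EuclideanSpace ℝ (Fin 3)) ⊆
      ((parabolicCylinderOpens 1 (0 : ℝ × EuclideanSpace ℝ (Fin 3)) :
        Opens (ℝ × EuclideanSpace ℝ (Fin 3))) : Set (ℝ × EuclideanSpace ℝ (Fin 3))) :=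
    parabolicCylinder_mono hρ.le (hρ4.trans (by norm_num)) _
  have hum : AEMeasurable (fun w : ℝ × EuclideanSpace ℝ (Fin 3) => ‖u w.1 w.2‖ₑ ^ (3 : ℕ))
      (volume.restrict (parabolicCylinder ρ 0)) :=
    ((hS.distributional.1.aestronglyMeasurable).mono_measure
      (Measure.restrict_mono hsub le_rfl)).aemeasurable.enorm.pow_const 3
  have hUP := setLIntegral_cubic_add_pressure_le_of_cknC_add_cknD_le hρ hum hsmall
  have key := H _ 3 u p G (by norm_num) hS 0 ρ ε₁ hρ hsub hε₁.le le_rfl hUP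
  refine ⟨ρ / 2, ⟨by positivity, by linarith⟩, ?_⟩
  rw [eLpNorm_exponent_top]
  exact eLpNormEssSup_lt_top_of_ae_bound key

end Literature.Analysis.FluidPDE

end
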